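import Literature.Probability.LatticeModels.SharpnessProofs

/-!
# Candidate proof of STUB 3 `stub_shellSummation` (line `sup-axis-reflection-transfer`, crux stmt-QuantumFields-9442)

Pure `Finset` combinatorics in `d = 4`: `#(sphere 4 n) ≤ 8 (2n+1)³` (tree `card_sphere_succ_le`), the lag window
`|j − ‖x‖∞| ≤ w` meets at most `2w+1` shells, and `2(j+w)+1 ≤ (2w+2)(j+1)`; so
`C = (2n₀+1)⁴ |K| + c (2w+1) 8 (2w+2)³ |M|` works. drefute seat refuter-drefute-stmt-QuantumFields-9442-0 (positive
by-product; NOT landed by the refuter — attached as item evidence for a prover).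
-/

noncomputable section

open Finset
open scoped BigOperators

namespace Summit.QuantumFields.YangMills.Cruxes.FiniteSusceptibilityWeakCoupling.SupAxisReflectionTransfer.ShellProof

open Literature.Probability.LatticeModels

/-- `#(sphere 4 n) ≤ 8 (2n+1)³` for every `n`. [folklore] -/
theorem card_sphere_four_le (n : ℕ) : (#(sphere 4 n) : ℝ) ≤ 8 * (2 * (n : ℝ) + 1) ^ 3 := by
  cases n with
  | zero =>
    have h : #(sphere 4 0) ≤ #(box 4 0) := card_le_card (sphere_subset_box 4 0)
    rw [card_box] at h
    norm_num at h ⊢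
    have : (#(sphere 4 0) : ℝ) ≤ 1 := by exact_mod_cast h
    linarith
  | succ k =>
    have h := card_sphere_succ_le (d := 4) k
    push_cast at h ⊢
    calc (#(sphere 4 (k + 1)) : ℝ) ≤ 2 * 4 * (2 * (k : ℝ) + 3) ^ (4 - 1) := h
      _ = 8 * (2 * ((k : ℝ) + 1) + 1) ^ 3 := by norm_num; ring

/-- The lag window `‖x‖∞ ≤ j + w ∧ j ≤ ‖x‖∞ + w` meets at most `2w+1` shells of `box 4 S`, each of size
`≤ 8 (2(j+w)+1)³`. [folklore] -/
theorem card_window_le (j w : ℕ) (s : Finset (Literature.Probability.LatticeModels.Site 4)) :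
    (#(s.filter fun x => Site.supNorm x ≤ j + w ∧ j ≤ Site.supNorm x + w) : ℝ) ≤
      (2 * (w : ℝ) + 1) * (8 * (2 * ((j : ℝ) + w) + 1) ^ 3) := by
  classical
  have hsub : (s.filter fun x => Site.supNorm x ≤ j + w ∧ j ≤ Site.supNorm x + w) ⊆
      (Finset.Icc (j - w) (j + w)).biUnion fun n => sphere 4 n := by
    intro x hx
    rw [Finset.mem_filter] at hx
    rw [Finset.mem_biUnion]
    refine ⟨Site.supNorm x, ?_, self_mem_sphere x⟩
    rw [Finset.mem_Icc]
    omega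
  have hcard : #(s.filter fun x => Site.supNorm x ≤ j + w ∧ j ≤ Site.supNorm x + w) ≤
      ∑ n ∈ Finset.Icc (j - w) (j + w), #(sphere 4 n) :=
    (card_le_card hsub).trans Finset.card_biUnion_le
  have hcardR : (#(s.filter fun x => Site.supNorm x ≤ j + w ∧ j ≤ Site.supNorm x + w) : ℝ) ≤
      ∑ n ∈ Finset.Icc (j - w) (j + w), (#(sphere 4 n) : ℝ) := by exact_mod_cast hcard
  refine hcardR.trans ?_
  calc ∑ n ∈ Finset.Icc (j - w) (j + w), (#(sphere 4 n) : ℝ)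
      ≤ ∑ _n ∈ Finset.Icc (j - w) (j + w), 8 * (2 * ((j : ℝ) + w) + 1) ^ 3 := by
        refine Finset.sum_le_sum fun n hn => ?_
        have hn' : n ≤ j + w := (Finset.mem_Icc.1 hn).2
        have hnR : (n : ℝ) ≤ (j : ℝ) + w := by exact_mod_cast hn'
        calc (#(sphere 4 n) : ℝ) ≤ 8 * (2 * (n : ℝ) + 1) ^ 3 := card_sphere_four_le n
          _ ≤ 8 * (2 * ((j : ℝ) + w) + 1) ^ 3 := by gcongr
    _ = (#(Finset.Icc (j - w) (j + w)) : ℝ) * (8 * (2 * ((j : ℝ) + w) + 1) ^ 3) := by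
        rw [Finset.sum_const, nsmul_eq_mul]
    _ ≤ (2 * (w : ℝ) + 1) * (8 * (2 * ((j : ℝ) + w) + 1) ^ 3) := by
        refine mul_le_mul_of_nonneg_right ?_ (by positivity)
        have h1 : #(Finset.Icc (j - w) (j + w)) ≤ 2 * w + 1 := by
          rw [Nat.card_Icc]; omega
        exact_mod_cast h1

/-- **STUB 3 (`ShellSummation`), verbatim statement of the registered `stub_shellSummation`.** [folklore] -/
theorem shellSummation : ∀ (n₀ w : ℕ) (K c M : ℝ), ∃ C : ℝ, ∀ (S : ℕ) (f : Literature.Probability.LatticeModels.Site 4 → ℝ) (g : ℕ → ℝ), 0 ≤ c → (∀ x ∈ Literature.Probability.LatticeModels.box 4 S, |f x| ≤ K) → (∀ j, 0 ≤ g j) → ∑ j ∈ Finset.range (S + 1), ((j : ℝ) + 1) ^ 3 * g j ≤ M → (∀ x ∈ Literature.Probability.LatticeModels.box 4 S, n₀ ≤ Literature.Probability.LatticeModels.Site.supNorm x → |f x| ≤ c * ∑ j ∈ (Finset.range (S + 1)).filter (fun j => Literature.Probability.LatticeModels.Site.supNorm x ≤ j + w ∧ j ≤ Literature.Probability.LatticeModels.Site.supNorm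 x + w), g j) → ∑ x ∈ Literature.Probability.LatticeModels.box 4 S, |f x| ≤ C := by
  classical
  intro n₀ w K c M
  -- the window constant: (2w+1) · 8 · (2w+2)³
  set D : ℝ := (2 * (w : ℝ) + 1) * (8 * (2 * (w : ℝ) + 2) ^ 3) with hD
  have hD0 : 0 ≤ D := by positivity
  refine ⟨(2 * (n₀ : ℝ) + 1) ^ 4 * |K| + c * D * |M|, ?_⟩
  intro S f g hc hK hg hM hdom
  -- split the box into small shells and large shells
  rw [← Finset.sum_filter_add_sum_filter_not (box 4 S) (fun x => Site.supNorm x < n₀) (fun x => |f x|)]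
  refine add_le_add ?_ ?_
  · -- small shells: at most `(2n₀+1)⁴` sites, each `≤ K ≤ |K|`
    have hsub : ((box 4 S).filter fun x => Site.supNorm x < n₀) ⊆ box 4 n₀ := by
      intro x hx
      rw [Finset.mem_filter] at hx
      exact mem_box_iff_supNorm_le.2 hx.2.le
    calc ∑ x ∈ (box 4 S).filter (fun x => Site.supNorm x < n₀), |f x|
        ≤ ∑ _x ∈ (box 4 S).filter (fun x => Site.supNorm x < n₀), |K| :=
          Finset.sum_le_sum fun x hx => (hK x (Finset.mem_filter.1 hx).1).trans (le_abs_self K)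
      _ = (#((box 4 S).filter fun x => Site.supNorm x < n₀) : ℝ) * |K| := by
          rw [Finset.sum_const, nsmul_eq_mul]
      _ ≤ (#(box 4 n₀) : ℝ) * |K| := by
          refine mul_le_mul_of_nonneg_right ?_ (abs_nonneg K)
          exact_mod_cast card_le_card hsub
      _ = (2 * (n₀ : ℝ) + 1) ^ 4 * |K| := by
          rw [card_box]; push_cast; ring
  · -- large shells: domination, exchange of sums, window card bound, cubic moment
    set T := (box 4 S).filter fun x => ¬ Site.supNorm x < n₀ with hT
    have hT_box : T ⊆ box 4 S := Finset.filter_subset _ _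
    have step1 : ∑ x ∈ T, |f x| ≤ ∑ x ∈ T, c * ∑ j ∈ (Finset.range (S + 1)).filter
        (fun j => Site.supNorm x ≤ j + w ∧ j ≤ Site.supNorm x + w), g j := by
      refine Finset.sum_le_sum fun x hx => ?_
      have hx' := Finset.mem_filter.1 hx
      exact hdom x hx'.1 (not_lt.1 hx'.2)
    refine step1.trans ?_
    rw [← Finset.mul_sum]
    -- exchange the sums
    have hex : ∑ x ∈ T, ∑ j ∈ (Finset.range (S + 1)).filter
          (fun j => Site.supNorm x ≤ j + w ∧ j ≤ Site.supNorm x + w), g j =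
        ∑ j ∈ Finset.range (S + 1),
          (#(T.filter fun x => Site.supNorm x ≤ j + w ∧ j ≤ Site.supNorm x + w) : ℝ) * g j := by
      have h1 : ∀ x ∈ T, ∑ j ∈ (Finset.range (S + 1)).filter
          (fun j => Site.supNorm x ≤ j + w ∧ j ≤ Site.supNorm x + w), g j =
          ∑ j ∈ Finset.range (S + 1),
            if Site.supNorm x ≤ j + w ∧ j ≤ Site.supNorm x + w then g j else 0 := fun x _ =>
        Finset.sum_filter _ _
      rw [Finset.sum_congr rfl h1, Finset.sum_comm]
      refine Finset.sum_congr rfl fun j _ => ?_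
      rw [← Finset.sum_filter, Finset.sum_const, nsmul_eq_mul]
    rw [hex]
    -- bound each window count and use the cubic moment
    have hwin : ∀ j ∈ Finset.range (S + 1),
        (#(T.filter fun x => Site.supNorm x ≤ j + w ∧ j ≤ Site.supNorm x + w) : ℝ) * g j ≤
          D * (((j : ℝ) + 1) ^ 3 * g j) := by
      intro j _
      have h1 := card_window_le j w T
      have h2 : (2 * ((j : ℝ) + w) + 1) ^ 3 ≤ (2 * (w : ℝ) + 2) ^ 3 * ((j : ℝ) + 1) ^ 3 := by
        rw [← mul_pow]
        apply pow_le_pow_left₀ (by positivity)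
        nlinarith [Nat.cast_nonneg (α := ℝ) j, Nat.cast_nonneg (α := ℝ) w]
      calc (#(T.filter fun x => Site.supNorm x ≤ j + w ∧ j ≤ Site.supNorm x + w) : ℝ) * g j
          ≤ (2 * (w : ℝ) + 1) * (8 * (2 * ((j : ℝ) + w) + 1) ^ 3) * g j :=
            mul_le_mul_of_nonneg_right h1 (hg j)
        _ ≤ (2 * (w : ℝ) + 1) * (8 * ((2 * (w : ℝ) + 2) ^ 3 * ((j : ℝ) + 1) ^ 3)) * g j := by
            gcongr
            exact hg j
        _ = D * (((j : ℝ) + 1) ^ 3 * g j) := by rw [hD]; ring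
    calc c * ∑ j ∈ Finset.range (S + 1),
          (#(T.filter fun x => Site.supNorm x ≤ j + w ∧ j ≤ Site.supNorm x + w) : ℝ) * g j
        ≤ c * ∑ j ∈ Finset.range (S + 1), D * (((j : ℝ) + 1) ^ 3 * g j) :=
          mul_le_mul_of_nonneg_left (Finset.sum_le_sum hwin) hc
      _ = c * D * ∑ j ∈ Finset.range (S + 1), ((j : ℝ) + 1) ^ 3 * g j := by
          rw [← Finset.mul_sum]; ring
      _ ≤ c * D * M := mul_le_mul_of_nonneg_left hM (mul_nonneg hc hD0)
      _ ≤ c * D * |M| := mul_le_mul_of_nonneg_left (le_abs_self M) (mul_nonneg hc hD0)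

end Summit.QuantumFields.YangMills.Cruxes.FiniteSusceptibilityWeakCoupling.SupAxisReflectionTransfer.ShellProof

end
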